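import Mathlib
import Summits.Schanuel.Schanuel.Theses.GaussianStokesSector
import Summits.Schanuel.Schanuel.Theorems.RigidCoreSchanuelOnLogFreeCoreSectorGlue
import Summits.Schanuel.Schanuel.Theorems.RigidCoreSchanuelOnLogFreeCoreRelLWZeroOffAxes
import Literature.NumberTheory.Transcendental.LindemannWeierstrassProofs

/-!
# Line `sector-split` (route `RigidCore`), skeleton v6: reduction of the π–LW sector to the axes

Prover file for the registered stub `stub_piFree_of_piFreeOnAxes` of line `sector-split`
(v6, axes refinement) of crux `stmt-Schanuel-0970`
(`Summit.Schanuel.Schanuel.Theses.RigidCore.SchanuelOnLogFreeCore`, "(R)": Schanuel's statement for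
`ℚ`-linearly independent tuples from the log-free core `C_EA`).

The line splits (R) ⟺ residue 1 ∧ residue 2, residue 1 = `GaussianStokesSector.PiFreeOverLWField`
(item stmt-Schanuel-9545: `π` is transcendental over the Lindemann–Weierstrass field
`ℚ(e^α : α ∈ ℚ̄)`, i.e. `d + 1 ≤ trdeg ℚ(π, e^{a})` for every `ℚ`-free algebraic `d`-tuple `a`).
This file proves the REDUCTION of residue 1 to the axes:

  ENGINE (exceptional subspaces of `η` are closed under `∩`) →
  RESIDUE 1′ (residue 1 for tuples whose entries are REAL or PURELY IMAGINARY) →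
  `PiFreeOverLWField`.

Both Schanuel-type inputs are HYPOTHESES of the theorem; the proof is Lindemann–Weierstrass
(tree theorem `Literature.NumberTheory.Transcendental.algebraicIndependent_exp_holds`, PROVED) plus
complex conjugation plus linear algebra:

1. Let `a` be `ℚ`-free algebraic and suppose `trdeg ℚ(π, e^{a}) ≤ d`.  By Lindemann–Weierstrass
   the `e^{a i}` are algebraically independent, so `π` is ALGEBRAIC over `F = ℚ(e^{a})`
   (`AlgebraicIndependent.sumElim_iff`).
2. `F ≤ ℚ(e^A)` for the span `A = span_ℚ(a) ≤ ℚ̄`, so `π` is algebraic over `ℚ(e^A)`.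
3. Complex conjugation is a `ℚ`-algebra automorphism of `ℂ` fixing `π` and commuting with `exp`,
   so `π` is algebraic over `ℚ(e^{Ā})`, `Ā = conj(A) ≤ ℚ̄`.
4. ENGINE: `π` is algebraic over `ℚ(e^U)`, `U = A ∩ Ā`.
5. `U` is finite-dimensional and conj-stable, hence spanned by the real parts and `i`·imaginary
   parts of its elements (`Re u = (u + ū)/2`, `i Im u = (u − ū)/2`); extract a `ℚ`-basis `u` of `U`
   from these ON-AXES vectors (`exists_linearIndependent`).
6. `e^x` is algebraic over `ℚ(e^{u})` for `x ∈ U = span_ℚ(u)` (products and rational powers), so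
   `π` is algebraic over `ℚ(e^{u})` and `trdeg ℚ(π, e^{u}) ≤ n < n + 1`, contradicting RESIDUE 1′
   at the on-axes `ℚ`-free algebraic tuple `u`.

No new definitions.  Helpers live in the sub-namespace `AxesReduction`.

References: A. Baker, *Transcendental Number Theory* (1975), Ch. 1 Thm 1.4 (Lindemann–Weierstrass);
S. Lang, *Introduction to Transcendental Numbers* (1966), Ch. I (transcendence bases, towers).
-/

noncomputable section

namespace Summit.Schanuel.Schanuel.Theorems.RigidCore

open Summit.Schanuel.Schanuel.Theses
open Literature.NumberTheory.Transcendental (algebraicIndependent_exp_holds)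
open Literature.Barriers.Schanuel (trdeg_adjoin_union_eq_of_isAlgebraic_adjoin)
open Summit.Schanuel.Schanuel.Theorems.AclSubsetLogFreeCore.Negative
open IntermediateField (adjoin subset_adjoin adjoin_le_iff)
open Complex (exp)
open Set Submodule

namespace AxesReduction

/-! ## Algebraicity bookkeeping over generated subfields of `ℂ` -/

/-- Algebraicity descends through an algebraic layer: if `T ⊆ M^{alg}` and `x` is algebraic over
`ℚ(T)`, then `x` is algebraic over `M` (`ℚ(T) ≤ M^{alg}`, and `M^{alg}` is relatively
algebraically closed). [folklore] -/
theorem isAlgebraic_of_subset_algebraicClosure (M : IntermediateField ℚ ℂ) {T : Set ℂ}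
    (hT : T ⊆ algebraicClosure M ℂ) {x : ℂ} (hx : IsAlgebraic (adjoin ℚ T) x) :
    IsAlgebraic M x := by
  have hle : adjoin ℚ T ≤ relAlg M :=
    adjoin_le_iff.2 fun w hw => mem_relAlg_iff.2 (mem_algebraicClosure_iff.1 (hT hw))
  exact mem_relAlg_iff.1 (relAlg_closed M x (isAlgebraic_of_le hle hx))

/-- Exponentials of a `ℚ`-span: if `e^{v i} ∈ K` for all `i`, then `e^x` is algebraic over `K`
for every `x ∈ span_ℚ(v)` (`e^{Σ qᵢ vᵢ} = Π e^{qᵢ vᵢ}` and `e^{q v}` is a root of a power of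
`e^{v}`). [folklore] -/
theorem exp_mem_algebraicClosure_of_mem_span {n : ℕ} (v : Fin n → ℂ)
    (K : IntermediateField ℚ ℂ) (hK : ∀ i, exp (v i) ∈ K) {x : ℂ}
    (hx : x ∈ span ℚ (Set.range v)) : exp x ∈ algebraicClosure K ℂ := by
  obtain ⟨c, rfl⟩ := (mem_span_range_iff_exists_fun ℚ).1 hx
  simp_rw [Rat.smul_def]
  rw [Complex.exp_sum]
  exact prod_mem fun i _ => SectorGlue.exp_rat_mul_mem_algebraicClosure K _ _
    (mem_algebraicClosure_iff.2 (isAlgebraic_algebraMap (⟨_, hK i⟩ : K)))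

/-- The `ℚ`-span of algebraic numbers consists of algebraic numbers. [folklore] -/
theorem isAlgebraic_of_mem_span {d : ℕ} {a : Fin d → ℂ} (ha : ∀ i, IsAlgebraic ℚ (a i)) {z : ℂ}
    (hz : z ∈ span ℚ (Set.range a)) : IsAlgebraic ℚ z :=
  mem_algebraicClosure_iff.1 ((span_le (p := Subalgebra.toSubmodule
    (algebraicClosure ℚ ℂ).toSubalgebra)).2
    (by rintro _ ⟨i, rfl⟩; exact mem_algebraicClosure_iff.2 (ha i)) hz)

/-! ## Complex conjugation -/

/-- Complex conjugation transports algebraicity over `ℚ(e^S)` to algebraicity of the conjugate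
over `ℚ(e^{S̄})`: `conj` is a `ℚ`-algebra endomorphism of `ℂ` mapping `ℚ(e^S)` onto `ℚ(e^{S̄})`
(`e^{z̄} = conj (e^z)`). [folklore] -/
theorem isAlgebraic_conj_adjoin_exp_image {S : Set ℂ} {x : ℂ}
    (hx : IsAlgebraic (adjoin ℚ (exp '' S)) x) :
    IsAlgebraic (adjoin ℚ (exp '' (⇑conjQ.toLinearMap '' S))) (conjQ x) := by
  set K := adjoin ℚ (exp '' S) with hK
  have h1 : IsAlgebraic (K.map conjQ) (conjQ x) :=
    hx.ringHom_of_comp_eq (K.equivMap conjQ : K →+* K.map conjQ) (conjQ : ℂ →+* ℂ)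
      (K.equivMap conjQ).injective (by ext; rfl)
  have h2 : K.map conjQ = adjoin ℚ (exp '' (⇑conjQ.toLinearMap '' S)) := by
    rw [hK, IntermediateField.adjoin_map, Set.image_image, Set.image_image]
    simp only [AlgHom.toLinearMap_apply, conjQ_apply, Complex.exp_conj]
  exact isAlgebraic_of_le h2.le h1

/-- A finite-dimensional conj-stable `ℚ`-subspace `U ≤ ℂ` is spanned by a `ℚ`-linearly
independent family of its elements lying ON THE AXES (real or purely imaginary): with `u ∈ U`
also `Re u = (u + ū)/2 ∈ U` and `i·Im u = (u − ū)/2 ∈ U`, and these vectors span `U`.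
[folklore] -/
theorem exists_onAxes_frame (U : Submodule ℚ ℂ) [FiniteDimensional ℚ U]
    (hU : ∀ u ∈ U, (starRingEnd ℂ) u ∈ U) :
    ∃ (n : ℕ) (u : Fin n → ℂ), (∀ i, u i ∈ U) ∧ (∀ i, (u i).im = 0 ∨ (u i).re = 0) ∧
      LinearIndependent ℚ u ∧ U ≤ span ℚ (Set.range u) := by
  let e := Module.finBasis ℚ U
  set s : Set ℂ := Set.range (fun j : Fin (Module.finrank ℚ U) => (((e j : ℂ)).re : ℂ)) ∪
    Set.range (fun j : Fin (Module.finrank ℚ U) => (((e j : ℂ)).im : ℂ) * Complex.I) with hs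
  have hsfin : s.Finite := (Set.finite_range _).union (Set.finite_range _)
  have hre : ∀ z ∈ U, ((z.re : ℂ)) ∈ U := fun z hz => by
    have h : (z.re : ℂ) = (2⁻¹ : ℚ) • (z + (starRingEnd ℂ) z) := by
      rw [Rat.smul_def, Complex.re_eq_add_conj]
      push_cast
      ring
    rw [h]
    exact U.smul_mem _ (U.add_mem hz (hU z hz))
  have him : ∀ z ∈ U, ((z.im : ℂ)) * Complex.I ∈ U := fun z hz => by
    have h : (z.im : ℂ) * Complex.I = (2⁻¹ : ℚ) • (z - (starRingEnd ℂ) z) := by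
      rw [Rat.smul_def]
      apply Complex.ext <;> simp
      ring
    rw [h]
    exact U.smul_mem _ (U.sub_mem hz (hU z hz))
  have hsU : s ⊆ U := by
    rintro z (⟨j, rfl⟩ | ⟨j, rfl⟩)
    exacts [hre _ (e j).2, him _ (e j).2]
  have hax : ∀ z ∈ s, z.im = 0 ∨ z.re = 0 := by
    rintro z (⟨j, rfl⟩ | ⟨j, rfl⟩)
    · left; simp
    · right; simp
  have hUs : U ≤ span ℚ s := by
    have hUe : span ℚ (Set.range (fun j => (e j : ℂ))) = U := by
      rw [show (fun j => (e j : ℂ)) = U.subtype ∘ e from rfl, Set.range_comp,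
        Submodule.span_image, e.span_eq, Submodule.map_subtype_top]
    rw [← hUe]
    refine span_le.2 ?_
    rintro _ ⟨j, rfl⟩
    have h := add_mem (subset_span (R := ℚ) (s := s) (Or.inl ⟨j, rfl⟩))
      (subset_span (R := ℚ) (s := s) (Or.inr ⟨j, rfl⟩))
    rwa [Complex.re_add_im] at h
  obtain ⟨b, hbs, hspan, hli⟩ := exists_linearIndependent ℚ s
  obtain ⟨n, f, rfl⟩ := (hsfin.subset hbs).fin_embedding
  refine ⟨n, f, fun i => hsU (hbs ⟨i, rfl⟩), fun i => hax _ (hbs ⟨i, rfl⟩),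
    (linearIndepOn_id_range_iff f.injective).1 hli, ?_⟩
  rw [hspan]
  exact hUs

/-! ## Transcendence-degree bookkeeping -/

/-- If `v` is algebraically independent over `ℚ` and `x` is transcendental over `ℚ(v)`, then
`trdeg ℚ(x, v) ≥ d + 1` (the `d + 1` numbers `(x, v)` are algebraically independent,
`AlgebraicIndependent.sumElim_iff`). [folklore] -/
theorem succ_le_trdeg_adjoin_insert {d : ℕ} {v : Fin d → ℂ} (hv : AlgebraicIndependent ℚ v)
    {x : ℂ} (hx : Transcendental (adjoin ℚ (Set.range v)) x) :
    ((d + 1 : ℕ) : Cardinal) ≤ Algebra.trdeg ℚ (adjoin ℚ (insert x (Set.range v))) := by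
  have h1 : AlgebraicIndependent ℚ (Sum.elim ![x] v) := by
    refine AlgebraicIndependent.sumElim_iff.2 ⟨hv, ?_⟩
    rw [algebraicIndependent_iff_transcendental, ← IntermediateField.transcendental_adjoin_iff]
    exact hx
  set L := adjoin ℚ (insert x (Set.range v)) with hL
  have hmem : ∀ i, Sum.elim ![x] v i ∈ L := by
    rintro (i | i)
    · fin_cases i
      exact subset_adjoin ℚ _ (Set.mem_insert _ _)
    · exact subset_adjoin ℚ _ (Set.mem_insert_of_mem _ ⟨i, rfl⟩)
  let y : Fin 1 ⊕ Fin d → L := fun i => ⟨_, hmem i⟩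
  have hy : AlgebraicIndependent ℚ y := AlgebraicIndependent.of_comp L.val h1
  have h := hy.cardinalMk_le_trdeg
  rw [Cardinal.mk_fintype, Fintype.card_sum, Fintype.card_fin, Fintype.card_fin] at h
  simpa [add_comm] using h

/-- If `x` is algebraic over `ℚ(v₁, …, v_n)` then `trdeg ℚ(x, v) ≤ n` (the algebraic adjunction
does not change the transcendence degree, and `n` generators give `trdeg ≤ n`). [folklore] -/
theorem trdeg_adjoin_insert_le_of_isAlgebraic {n : ℕ} (v : Fin n → ℂ) {x : ℂ}
    (hx : IsAlgebraic (adjoin ℚ (Set.range v)) x) :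
    Algebra.trdeg ℚ (adjoin ℚ (insert x (Set.range v))) ≤ (n : Cardinal) := by
  -- (the two sides carry the generic `IntermediateField.algebra'` resp. the `ℚ`-specific
  -- `DivisionRing.toRatAlgebra` instance: combine by `exact`, not by `rw`)
  have h1 := trdeg_adjoin_union_eq_of_isAlgebraic_adjoin (K := ℚ) (Set.range v) {x}
    (fun w hw => by rwa [Set.mem_singleton_iff.1 hw])
  rw [Set.union_singleton] at h1
  exact h1.trans_le
    (Literature.NumberTheory.Transcendental.Philippon1986_criterion.trdeg_adjoin_range_le v)

end AxesReduction

/-- **Registered stub `stub_piFree_of_piFreeOnAxes` of line `sector-split` (v6)** — signature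
verbatim: the ENGINE (exceptional subspaces are closed under intersection) and RESIDUE 1′ (the
π–LW sector for `ℚ`-free algebraic tuples ON THE AXES) imply residue 1
`GaussianStokesSector.PiFreeOverLWField` (item stmt-Schanuel-9545).  Lindemann–Weierstrass makes
`π` algebraic over `ℚ(e^{a})` once `trdeg ℚ(π, e^{a}) ≤ d`; then over `ℚ(e^A)`, `A = span_ℚ(a)`,
over `ℚ(e^{Ā})` (conjugation fixes `π`), over `ℚ(e^{A ∩ Ā})` (engine); `A ∩ Ā` is conj-stable,
hence spanned by an on-axes `ℚ`-free algebraic tuple `u`, and `trdeg ℚ(π, e^{u}) ≤ n` contradicts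
residue 1′ at `u`. [cite: BakerTNT1975, Ch. 1 Thm 1.4] -/
theorem stub_piFree_of_piFreeOnAxes :
    (∀ (η : ℂ) (A B : Submodule ℚ ℂ), (∀ z ∈ A, IsAlgebraic ℚ z) → (∀ z ∈ B, IsAlgebraic ℚ z) →
      IsAlgebraic ↥(IntermediateField.adjoin ℚ (Complex.exp '' (A : Set ℂ))) η →
      IsAlgebraic ↥(IntermediateField.adjoin ℚ (Complex.exp '' (B : Set ℂ))) η →
      IsAlgebraic ↥(IntermediateField.adjoin ℚ (Complex.exp '' ((A ⊓ B : Submodule ℚ ℂ) : Set ℂ))) η) →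
    (∀ (d : ℕ) (a : Fin d → ℂ), (∀ i, IsAlgebraic ℚ (a i)) → (∀ i, (a i).im = 0 ∨ (a i).re = 0) →
      LinearIndependent ℚ a →
      ((d + 1 : ℕ) : Cardinal) ≤ Algebra.trdeg ℚ
        ↥(IntermediateField.adjoin ℚ (insert (Real.pi : ℂ) (Set.range (Complex.exp ∘ a))))) →
    GaussianStokesSector.PiFreeOverLWField := by
  intro hE hAxes d a ha hli
  -- (1) Lindemann–Weierstrass: if the count fails, `π` is algebraic over `ℚ(e^{a})`
  have hLW : AlgebraicIndependent ℚ (exp ∘ a) := algebraicIndependent_exp_holds a ha hli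
  by_contra hlt
  have h1 : IsAlgebraic (adjoin ℚ (Set.range (exp ∘ a))) (Real.pi : ℂ) := by
    by_contra htr
    exact hlt (AxesReduction.succ_le_trdeg_adjoin_insert hLW htr)
  -- (2) the span `A = span_ℚ(a) ≤ ℚ̄`
  set A : Submodule ℚ ℂ := span ℚ (Set.range a) with hA
  have hAalg : ∀ z ∈ A, IsAlgebraic ℚ z := fun z hz => AxesReduction.isAlgebraic_of_mem_span ha hz
  have h2 : IsAlgebraic (adjoin ℚ (exp '' (A : Set ℂ))) (Real.pi : ℂ) :=
    isAlgebraic_of_le (IntermediateField.adjoin.mono ℚ _ _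
      (by rintro _ ⟨i, rfl⟩; exact ⟨a i, subset_span ⟨i, rfl⟩, rfl⟩)) h1
  -- (3) conjugation: `π` is algebraic over `ℚ(e^{Ā})`
  set A' : Submodule ℚ ℂ := A.map conjQ.toLinearMap with hA'
  have hA'alg : ∀ z ∈ A', IsAlgebraic ℚ z := fun z hz => by
    obtain ⟨y, hy, rfl⟩ := Submodule.mem_map.1 hz
    exact (hAalg y hy).algHom conjQ
  have h3 : IsAlgebraic (adjoin ℚ (exp '' (A' : Set ℂ))) (Real.pi : ℂ) := by
    have h := AxesReduction.isAlgebraic_conj_adjoin_exp_image h2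
    rw [conjQ_apply, Complex.conj_ofReal] at h
    rwa [hA', Submodule.map_coe]
  -- (4) engine: `π` is algebraic over `ℚ(e^{A ∩ Ā})`
  have h4 := hE _ A A' hAalg hA'alg h2 h3
  -- (5) `A ∩ Ā` is finite-dimensional and conj-stable: an on-axes basis `u`
  haveI : FiniteDimensional ℚ A := FiniteDimensional.span_of_finite ℚ (Set.finite_range a)
  haveI : FiniteDimensional ℚ ↥(A ⊓ A') := finiteDimensional_of_le inf_le_left
  have hUconj : ∀ u ∈ A ⊓ A', (starRingEnd ℂ) u ∈ A ⊓ A' := by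
    intro u hu
    obtain ⟨huA, huA'⟩ := Submodule.mem_inf.1 hu
    obtain ⟨y, hy, hyu⟩ := Submodule.mem_map.1 huA'
    refine Submodule.mem_inf.2 ⟨?_, Submodule.mem_map.2 ⟨u, huA, rfl⟩⟩
    have h : (starRingEnd ℂ) u = y := by rw [← hyu]; simp
    rw [h]
    exact hy
  obtain ⟨n, u, huU, hax, huli, hUle⟩ := AxesReduction.exists_onAxes_frame (A ⊓ A') hUconj
  -- (6) `π` is algebraic over `ℚ(e^{u})`: `trdeg ℚ(π, e^{u}) ≤ n`, against residue 1′ at `u`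
  set Ku := adjoin ℚ (Set.range (exp ∘ u)) with hKu
  have h6 : IsAlgebraic Ku (Real.pi : ℂ) := by
    refine AxesReduction.isAlgebraic_of_subset_algebraicClosure Ku ?_ h4
    rintro _ ⟨x, hx, rfl⟩
    exact AxesReduction.exp_mem_algebraicClosure_of_mem_span u Ku
      (fun i => subset_adjoin ℚ _ ⟨i, rfl⟩) (hUle hx)
  have hup := AxesReduction.trdeg_adjoin_insert_le_of_isAlgebraic (exp ∘ u) h6
  have hlow := hAxes n u
    (fun i => AxesReduction.isAlgebraic_of_mem_span ha (Submodule.mem_inf.1 (huU i)).1) hax huli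
  have h := hlow.trans hup
  norm_cast at h
  omega

end Summit.Schanuel.Schanuel.Theorems.RigidCore

end
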